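import Summits.HubbardSuperconductivity.HubbardSuperconductivity.Theorems.AnisotropyChordTransferFibre3FinX3Eval

/-!
# Route `AnisotropyChord` / H0 rotor rung: FIN per-`L` GM₃ (X5), `L = 31` — rows `N₁` / D / side-condition cell facts, part `p57`

Kernel facts (`decide +kernel`) for cert cells 134, 135 of the per-`L` grid of `L = 31`: `xbnCellAny2` (row `N₁` on XB2 point wedges recomputed in the kernel, exporting the literal brackets `nt ⊇ T⁺ − 3λ₂` and `tb ⊇ T⁺·D`), `xdCellAnyN0` (row D, reads `nt`), `sdCellAnyZN` (side condition, reads `nt`); evaluators `…FinX3Eval` / `…FinX5Eval`; constants from the compiled design probe (x3probe/x3plan, margins c ×0.985, b ×1.03, aD ×1.03); assembled in `…FinX5GM3ThirtyOne`.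
Prover seat `hubbard-h0-rotor-p3` g8; helper for piece A = stmt-HubbardSuperconductivity-23918 of rung 19089 (`--supports`, helper class).
WHAT THIS IS NOT: nothing here proves superconductivity in the Hubbard model (rotor TARGET as worded stays FALSE, g15 verdict); kernel facts for the FIN certificate of ONE conditional reduction.  Tree imports only; zero data; standard axioms.
-/

set_option linter.dupNamespace false
set_option autoImplicit false

namespace Summit.HubbardSuperconductivity.HubbardSuperconductivity.Theorems.AnisotropyChord.Transfer.Fibre3

namespace FinXD

open FinXB FinCell Hole2

set_option maxHeartbeats 4000000 in
/-- row `N₁` of cell 134 of `L = 31` (`c = 113/200`), exporting `nt`, `tb`. [folklore] -/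
theorem xn31_134 : xbnCellAny2 31 (49/50 : ℚ) 1483982947420380 1521082521105890 (113/200 : ℚ) ((34214349130213 : ℤ), (49964686656095 : ℤ)) ((4486136018852033 : ℤ), (4613239422513085 : ℤ)) = true := by decide +kernel

set_option maxHeartbeats 4000000 in
/-- row D of cell 134 of `L = 31` (`aD = 77/1000`). [folklore] -/
theorem xd31_134 : xdCellAnyN0 31 (49/50 : ℚ) 1483982947420380 1521082521105890 (77/1000 : ℚ) ((34214349130213 : ℤ), (49964686656095 : ℤ)) = true := by decide +kernel

set_option maxHeartbeats 4000000 in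
/-- side condition of cell 134 of `L = 31` (`c, b = 124/100, aD`). [folklore] -/
theorem sd31_134 : sdCellAnyZN 31 (49/50 : ℚ) 100 1483982947420380 1521082521105890 ((113/200 : ℚ), (124 : ℕ), (77/1000 : ℚ)) ((34214349130213 : ℤ), (49964686656095 : ℤ)) = true := by decide +kernel

set_option maxHeartbeats 4000000 in
/-- row `N₁` of cell 135 of `L = 31` (`c = 14/25`), exporting `nt`, `tb`. [folklore] -/
theorem xn31_135 : xbnCellAny2 31 (49/50 : ℚ) 1521082521105890 1559109584133538 (14/25 : ℚ) ((36574735273544 : ℤ), (53521690236065 : ℤ)) ((4599794446738410 : ℤ), (4730878294489483 : ℤ)) = true := by decide +kernel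

set_option maxHeartbeats 4000000 in
/-- row D of cell 135 of `L = 31` (`aD = 77/1000`). [folklore] -/
theorem xd31_135 : xdCellAnyN0 31 (49/50 : ℚ) 1521082521105890 1559109584133538 (77/1000 : ℚ) ((36574735273544 : ℤ), (53521690236065 : ℤ)) = true := by decide +kernel

set_option maxHeartbeats 4000000 in
/-- side condition of cell 135 of `L = 31` (`c, b = 127/100, aD`). [folklore] -/
theorem sd31_135 : sdCellAnyZN 31 (49/50 : ℚ) 100 1521082521105890 1559109584133538 ((14/25 : ℚ), (127 : ℕ), (77/1000 : ℚ)) ((36574735273544 : ℤ), (53521690236065 : ℤ)) = true := by decide +kernel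

end FinXD

end Summit.HubbardSuperconductivity.HubbardSuperconductivity.Theorems.AnisotropyChord.Transfer.Fibre3
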